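import Summits.ABC.IUTFork.Thm311MultiradProofs
import Literature.IUT.LogVolume.HaarTransport
import HarnessLib

/-!
# [IUTchIII] Theorem 3.11 (i): the log-volume invariance clause — `LogvolInvariant` from real measures

PROOF-ONLY companion (no definitions, no signatures) to abc-iut-c312-1's record-only file B
`Thm311Multirad` of the abc-iut cell, written by the wave-3 discharge seat abc-iut-c312-d1; TAKES NO SIDE.

File B names, and deliberately does NOT assume, the property of the data (a) of [IUTchIII] Thm. 3.11 (i)
that every downstream use of the multiradial representation consumes:
`MRData.LogvolInvariant D` — "the log-volumes of (a) are unchanged by every indeterminacy move out of `D`"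
= the first clause of Step (x) of the proof of Cor. 3.12 (kurims p. 181 l. 5–13: "the procession-normalized
mono-analytic log-volumes … are invariant with respect to the indeterminacies (Ind1), (Ind2)") = what
[IUTchIV] Thm. 1.10 Step (v) uses ("(Ind1), (Ind2): permutations of tensor factors and isometries preserve
the normalized log-volume", B's docstring) = Dupuy–Hilado §4.7 ((Ind1) "fixes the lattice") and §4.9
footnote ((Ind2) "the measure of sets are preserved under these maps"). B's docstring: "NOT assumed
anywhere; named so that instantiations state and prove it".

This file DISCHARGES that name down to classical measure theory: it proves `LogvolInvariant D` for every
`D : MRData L` whose log-volume is a REAL normalised Haar log-volume — i.e. `D.logvol j v_ℚ A =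
μ^log_{Λ_{j,v_ℚ}}(e_{j,v_ℚ}(A))/d_{j,v_ℚ}` for some map `e_{j,v_ℚ}` of B's (bare `ℚ`-module) tensor packet
into a topologised container `W_{j,v_ℚ}` carrying an integral structure `Λ_{j,v_ℚ}`
(`Literature.IUT.LogVolume.IntegralStructure`, the campaign's volume vocabulary) — as soon as every
(Ind1)-family and every (Ind2)-family acts, through `e`, by VOLUME-PRESERVING additive homeomorphisms of
the containers (`logvolInvariant_of_volumePreserving`); in particular as soon as they act by LATTICE
AUTOMORPHISMS, i.e. additive homeomorphisms mapping SOME compact open subgroup onto itself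
(`logvolInvariant_of_latticeAutomorphisms`, by `IntegralStructure.haar_image_of_preserves` of
`Literature/IUT/LogVolume/HaarTransport.lean`: a lattice automorphism preserves EVERY normalised Haar
measure, whichever lattice normalises it — Dupuy–Hilado's (Ind2) fixes the log-shell `I_v`, not `O_v`).
`logvolInvariant_of_generators` states the same at the level of B's generators of (Ind1)/(Ind2)
(A's `LogShells.permute` / `factorwise ∘ summandwise` of strip-automorphisms resp. of `Ism`): it suffices
that each capsule permutation and each factor-and-summand-wise family is realised on the container by a
volume-preserving map. Finally `adm_and_logvol_eq_of_real` feeds the result into abc-iut-L6-t13's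
propagation theorem `MRData.adm_and_logvol_eq_of_mem_closure`: with admissibility read as "positive finite
volume of the image", EVERY element of the indeterminacy subgroup `⟨Ind1Family ∪ Ind2Family⟩` (file G's
`IndGroup`) carries admissible regions to admissible regions of the same log-volume — the whole-orbit form
consumed by Cor. 3.12's "possible images".

What remains for an INSTANCE (c312-5's `Real*` binders `logvol`/`Adm`, c312-3's DH packet models, the
campaign-S tensor packets): exhibit the container, the map `e`, and for each generator the intertwining
volume-preserving homeomorphism — for (Ind2) at a finite prime a `ℤ_p`-lattice isomorphism of `I_v`
(`haar_image_of_preserves`) or `±1` (`haar_neg`), for (Ind1) the re-indexing of tensor factors carrying the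
integral structure onto itself (`haar_image_equiv`) and strip isomorphisms acting isometrically
(`localVolume_image_equiv_of_norm_map_eq`). Sources read on the page: [IUTchIII] kurims pp. 153–155
(Thm. 3.11 (i), (Ind1), (Ind2)), p. 181 (Step (x)); Dupuy–Hilado §4.7, §4.9.
[claim: Mochizuki2012, status: disputed] for the quoted statements; every theorem below is [folklore]
measure theory and assumes nothing about Theorem 3.11. Deliberately NOT here: any container (no `def`),
(ii), (iii), (Ind3), any judgement on Cor. 3.12.
-/

noncomputable section

open MeasureTheory Set
open Literature.IUT.LogVolume

namespace Summit.ABC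

namespace IUTFork

namespace Thm311

variable {T : ThetaIndex} {L : LogShells T}

namespace MRData

variable (D : MRData L)
variable {W : T.Label → T.VQ → Type*} [∀ j vQ, AddCommGroup (W j vQ)]
  [∀ j vQ, TopologicalSpace (W j vQ)] [∀ j vQ, IsTopologicalAddGroup (W j vQ)]
  [∀ j vQ, MeasurableSpace (W j vQ)] [∀ j vQ, BorelSpace (W j vQ)]
  (Λ : ∀ j vQ, IntegralStructure (W j vQ)) (d : T.Label → T.VQ → ℕ)
  (e : ∀ (j : T.Label) (vQ : T.VQ), L.Packet j vQ → W j vQ)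

/-- Transport of an image along an intertwining relation: if `e ∘ Φ = ψ ∘ e` pointwise then
`e(Φ(A)) = ψ(e(A))`. [folklore] -/
private theorem image_image_of_semiconj {α β : Type*} {Φ : α → α} {ψ : β → β} {f : α → β}
    (h : ∀ x, f (Φ x) = ψ (f x)) (A : Set α) : f '' (Φ '' A) = ψ '' (f '' A) := by
  rw [Set.image_image, Set.image_image]
  exact Set.image_congr fun x _ => h x

/-- **`LogvolInvariant` from volume-preserving realisations.** Let the log-volume of the data (a) be a real
normalised Haar log-volume read through maps `e_{j,v_ℚ}` of the tensor packets into topologised containers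
with integral structures `Λ_{j,v_ℚ}` (`D.logvol j v_ℚ A = μ^log_{Λ}(e(A))/d`). If every (Ind1)-family and
every (Ind2)-family `Φ` is realised on each container by an additive homeomorphism `ψ` preserving the
volume `μ_Λ` (`e ∘ Φ_{j,v_ℚ} = ψ ∘ e`), then the log-volumes of (a) are invariant under every indeterminacy
move: B's `LogvolInvariant D` HOLDS. (Step (x): "invariant with respect to the indeterminacies (Ind1),
(Ind2)".) [folklore] -/
theorem logvolInvariant_of_volumePreserving
    (hlogvol : ∀ (j : T.Label) (vQ : T.VQ) (A : Set (L.Packet j vQ)),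
      D.logvol j vQ A = (Λ j vQ).normalizedLogVolume (d j vQ) (e j vQ '' A))
    (hInd : ∀ Φ : L.PacketAut, (Φ ∈ L.Ind1Family ∨ Φ ∈ L.Ind2Family) → ∀ (j : T.Label) (vQ : T.VQ),
      ∃ ψ : W j vQ ≃ₜ+ W j vQ, (∀ B : Set (W j vQ), (Λ j vQ).haar (ψ '' B) = (Λ j vQ).haar B) ∧
        ∀ x, e j vQ (Φ j vQ x) = ψ (e j vQ x)) :
    D.LogvolInvariant := by
  intro Φ hΦ j vQ A _
  obtain ⟨ψ, hψ, hcomm⟩ := hInd Φ hΦ j vQ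
  rw [hlogvol, hlogvol, image_image_of_semiconj hcomm A]
  simp only [IntegralStructure.normalizedLogVolume, IntegralStructure.logVolume, hψ]

/-- **`LogvolInvariant` from lattice automorphisms** (Dupuy–Hilado's description of (Ind1)/(Ind2)): with
the log-volume read through `e` as above, if every (Ind1)- or (Ind2)-family is realised on each container by
an additive homeomorphism mapping SOME compact open subgroup `Λ₀` onto itself ("fixes the lattice";
"`ℤ_p`-lattice isomorphisms of `I_v`" — the fixed lattice need not be the normalising one), then B's
`LogvolInvariant D` holds (`IntegralStructure.haar_image_of_preserves`: lattice automorphisms preserve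
every normalised Haar measure). [folklore] -/
theorem logvolInvariant_of_latticeAutomorphisms
    (hlogvol : ∀ (j : T.Label) (vQ : T.VQ) (A : Set (L.Packet j vQ)),
      D.logvol j vQ A = (Λ j vQ).normalizedLogVolume (d j vQ) (e j vQ '' A))
    (hInd : ∀ Φ : L.PacketAut, (Φ ∈ L.Ind1Family ∨ Φ ∈ L.Ind2Family) → ∀ (j : T.Label) (vQ : T.VQ),
      ∃ (ψ : W j vQ ≃ₜ+ W j vQ) (Λ₀ : IntegralStructure (W j vQ)),
        ψ '' (Λ₀ : Set (W j vQ)) = (Λ₀ : Set (W j vQ)) ∧ ∀ x, e j vQ (Φ j vQ x) = ψ (e j vQ x)) :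
    D.LogvolInvariant :=
  D.logvolInvariant_of_volumePreserving Λ d e hlogvol fun Φ hΦ j vQ => by
    obtain ⟨ψ, Λ₀, hΛ₀, hcomm⟩ := hInd Φ hΦ j vQ
    exact ⟨ψ, fun B => (Λ j vQ).haar_image_of_preserves ψ Λ₀ hΛ₀ B, hcomm⟩

/-- **`LogvolInvariant` from the generators of (Ind1), (Ind2).** By A's definitions, an (Ind1)-family is, at
each `(j, v_ℚ)`, `permute σ` followed by `factorwise (summandwise h)` for a capsule permutation `σ` (the
same at every `v_ℚ`) and strip-automorphisms `h_{i,v} ∈ stripAut v`; an (Ind2)-family is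
`factorwise (summandwise g)` with `g_{i,v} ∈ Ism v`. Hence it suffices that (P) every capsule permutation,
(S) every factor-and-summand-wise family of strip-automorphisms and (I) every such family of elements of
`Ism` be realised on the container by a `μ_Λ`-preserving additive homeomorphism — "permutations of tensor
factors and isometries preserve the normalized log-volume". [folklore] -/
theorem logvolInvariant_of_generators
    (hlogvol : ∀ (j : T.Label) (vQ : T.VQ) (A : Set (L.Packet j vQ)),
      D.logvol j vQ A = (Λ j vQ).normalizedLogVolume (d j vQ) (e j vQ '' A))
    (hP : ∀ (j : T.Label) (vQ : T.VQ) (σ : Equiv.Perm (T.Caps j)),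
      ∃ ψ : W j vQ ≃ₜ+ W j vQ, (∀ B : Set (W j vQ), (Λ j vQ).haar (ψ '' B) = (Λ j vQ).haar B) ∧
        ∀ x, e j vQ (L.permute j vQ σ x) = ψ (e j vQ x))
    (hS : ∀ (j : T.Label) (vQ : T.VQ) (g : T.Caps j → ∀ v : T.Fibre vQ, L.carrier v.1 ≃ₗ[ℚ] L.carrier v.1),
      (∀ i v, g i v ∈ L.stripAut v.1) →
      ∃ ψ : W j vQ ≃ₜ+ W j vQ, (∀ B : Set (W j vQ), (Λ j vQ).haar (ψ '' B) = (Λ j vQ).haar B) ∧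
        ∀ x, e j vQ (L.factorwise j vQ (fun i => L.summandwise vQ (g i)) x) = ψ (e j vQ x))
    (hI : ∀ (j : T.Label) (vQ : T.VQ) (g : T.Caps j → ∀ v : T.Fibre vQ, L.carrier v.1 ≃ₗ[ℚ] L.carrier v.1),
      (∀ i v, g i v ∈ L.ism v.1) →
      ∃ ψ : W j vQ ≃ₜ+ W j vQ, (∀ B : Set (W j vQ), (Λ j vQ).haar (ψ '' B) = (Λ j vQ).haar B) ∧
        ∀ x, e j vQ (L.factorwise j vQ (fun i => L.summandwise vQ (g i)) x) = ψ (e j vQ x)) :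
    D.LogvolInvariant := by
  refine D.logvolInvariant_of_volumePreserving Λ d e hlogvol fun Φ hΦ j vQ => ?_
  rcases hΦ with hΦ | hΦ
  · -- (Ind1): `Φ j v_ℚ = (permute σ).trans (factorwise (summandwise h))`
    obtain ⟨σ, h, hh, hΦj⟩ := hΦ j
    obtain ⟨ψP, hψP, hcommP⟩ := hP j vQ σ
    obtain ⟨ψS, hψS, hcommS⟩ := hS j vQ (fun i v => h i v.1) fun i v => hh i v.1
    refine ⟨ψP.trans ψS, fun B => ?_, fun x => ?_⟩
    · have : (ψP.trans ψS : W j vQ → W j vQ) '' B = ψS '' (ψP '' B) := by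
        rw [Set.image_image]; rfl
      rw [this, hψS, hψP]
    · have hΦj' : Φ j vQ = (L.permute j vQ σ).trans
          (L.factorwise j vQ fun i => L.summandwise vQ fun v => h i v.1) := hΦj vQ
      have hx : Φ j vQ x = L.factorwise j vQ (fun i => L.summandwise vQ fun v => h i v.1)
          (L.permute j vQ σ x) := by
        rw [hΦj']; rfl
      rw [hx, hcommS, hcommP]
      rfl
  · -- (Ind2): `Φ j v_ℚ = factorwise (summandwise g)`
    obtain ⟨g, hg, hΦj⟩ := hΦ j vQ
    obtain ⟨ψ, hψ, hcomm⟩ := hI j vQ g hg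
    exact ⟨ψ, hψ, fun x => by rw [hΦj]; exact hcomm x⟩

/-- **Admissibility transport from volume-preserving realisations.** If admissibility of a region of the
tensor packet is read as "the image in the container has positive finite volume" (the "nonempty compact
open subsets" of [IUTchIII] Prop. 3.9 (i) have exactly this property), then every (Ind1)- or (Ind2)-family
realised by volume-preserving maps carries admissible regions to admissible regions, in both directions —
the hypothesis `hAdm` of abc-iut-L6-t13's `adm_iff_and_logvol_eq_of_mem_closure`. [folklore] -/
theorem adm_iff_adm_image_of_volumePreserving
    (hAdm : ∀ (j : T.Label) (vQ : T.VQ) (A : Set (L.Packet j vQ)),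
      D.Adm j vQ A ↔ 0 < (Λ j vQ).haar (e j vQ '' A) ∧ (Λ j vQ).haar (e j vQ '' A) < ⊤)
    (hInd : ∀ Φ : L.PacketAut, (Φ ∈ L.Ind1Family ∨ Φ ∈ L.Ind2Family) → ∀ (j : T.Label) (vQ : T.VQ),
      ∃ ψ : W j vQ ≃ₜ+ W j vQ, (∀ B : Set (W j vQ), (Λ j vQ).haar (ψ '' B) = (Λ j vQ).haar B) ∧
        ∀ x, e j vQ (Φ j vQ x) = ψ (e j vQ x)) :
    ∀ Φ ∈ L.Ind1Family ∪ L.Ind2Family, ∀ (j : T.Label) (vQ : T.VQ) (A : Set (L.Packet j vQ)),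
      D.Adm j vQ A ↔ D.Adm j vQ (Φ j vQ '' A) := by
  intro Φ hΦ j vQ A
  obtain ⟨ψ, hψ, hcomm⟩ := hInd Φ ((Set.mem_union _ _ _).1 hΦ) j vQ
  rw [hAdm, hAdm, image_image_of_semiconj hcomm A, hψ]

/-- **The whole-orbit form, from real measures.** Under the two readings above (log-volume = transported
normalised Haar log-volume; admissible = positive finite volume of the image) and volume-preserving
realisations of the (Ind1)- and (Ind2)-families, EVERY element `Φ` of the indeterminacy subgroup
`⟨Ind1Family ∪ Ind2Family⟩` carries every admissible region to an admissible region OF THE SAME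
LOG-VOLUME — abc-iut-L6-t13's propagation theorem with both its hypotheses discharged; the form in which
Cor. 3.12 ("the union of the possible images … in the multiradial representation") and [IUTchIV] Thm. 1.10
Step (v) consume (Ind1), (Ind2). [folklore] -/
theorem adm_and_logvol_eq_of_real
    (hlogvol : ∀ (j : T.Label) (vQ : T.VQ) (A : Set (L.Packet j vQ)),
      D.logvol j vQ A = (Λ j vQ).normalizedLogVolume (d j vQ) (e j vQ '' A))
    (hAdm : ∀ (j : T.Label) (vQ : T.VQ) (A : Set (L.Packet j vQ)),
      D.Adm j vQ A ↔ 0 < (Λ j vQ).haar (e j vQ '' A) ∧ (Λ j vQ).haar (e j vQ '' A) < ⊤)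
    (hInd : ∀ Φ : L.PacketAut, (Φ ∈ L.Ind1Family ∨ Φ ∈ L.Ind2Family) → ∀ (j : T.Label) (vQ : T.VQ),
      ∃ ψ : W j vQ ≃ₜ+ W j vQ, (∀ B : Set (W j vQ), (Λ j vQ).haar (ψ '' B) = (Λ j vQ).haar B) ∧
        ∀ x, e j vQ (Φ j vQ x) = ψ (e j vQ x))
    {Φ : L.PacketAut} (hΦ : Φ ∈ Subgroup.closure (L.Ind1Family ∪ L.Ind2Family))
    (j : T.Label) (vQ : T.VQ) (A : Set (L.Packet j vQ)) (hA : D.Adm j vQ A) :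
    D.Adm j vQ (Φ j vQ '' A) ∧ D.logvol j vQ (Φ j vQ '' A) = D.logvol j vQ A :=
  D.adm_and_logvol_eq_of_mem_closure (D.adm_iff_adm_image_of_volumePreserving Λ e hAdm hInd)
    (D.logvolInvariant_of_volumePreserving Λ d e hlogvol hInd) hΦ j vQ A hA

end MRData

namespace Situation

/-- For the situation of Theorem 3.11: if the data of EVERY vertical line read their log-volumes and
admissibility through real measures as above, with volume-preserving realisations of (Ind1)/(Ind2), then
along the whole indeterminacy subgroup admissible regions keep their log-volume, at every line `n` —
literally abc-iut-c312-1's `LatticeSituation.LogvolIndInvariant` (file G) at `D = S.D n`, now a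
consequence of measure theory rather than a hypothesis. [folklore] -/
theorem adm_and_logvol_eq_of_real (S : Situation T)
    {W : T.Label → T.VQ → Type*} [∀ j vQ, AddCommGroup (W j vQ)]
    [∀ j vQ, TopologicalSpace (W j vQ)] [∀ j vQ, IsTopologicalAddGroup (W j vQ)]
    [∀ j vQ, MeasurableSpace (W j vQ)] [∀ j vQ, BorelSpace (W j vQ)]
    (Λ : ∀ j vQ, IntegralStructure (W j vQ)) (d : T.Label → T.VQ → ℕ)
    (e : ∀ (j : T.Label) (vQ : T.VQ), S.L.Packet j vQ → W j vQ)
    (hlogvol : ∀ (n : ℤ) (j : T.Label) (vQ : T.VQ) (A : Set (S.L.Packet j vQ)),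
      (S.D n).logvol j vQ A = (Λ j vQ).normalizedLogVolume (d j vQ) (e j vQ '' A))
    (hAdm : ∀ (n : ℤ) (j : T.Label) (vQ : T.VQ) (A : Set (S.L.Packet j vQ)),
      (S.D n).Adm j vQ A ↔ 0 < (Λ j vQ).haar (e j vQ '' A) ∧ (Λ j vQ).haar (e j vQ '' A) < ⊤)
    (hInd : ∀ Φ : S.L.PacketAut, (Φ ∈ S.L.Ind1Family ∨ Φ ∈ S.L.Ind2Family) →
      ∀ (j : T.Label) (vQ : T.VQ),
      ∃ ψ : W j vQ ≃ₜ+ W j vQ, (∀ B : Set (W j vQ), (Λ j vQ).haar (ψ '' B) = (Λ j vQ).haar B) ∧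
        ∀ x, e j vQ (Φ j vQ x) = ψ (e j vQ x))
    (n : ℤ) {Φ : S.L.PacketAut} (hΦ : Φ ∈ Subgroup.closure (S.L.Ind1Family ∪ S.L.Ind2Family))
    (j : T.Label) (vQ : T.VQ) (A : Set (S.L.Packet j vQ)) (hA : (S.D n).Adm j vQ A) :
    (S.D n).Adm j vQ (Φ j vQ '' A) ∧ (S.D n).logvol j vQ (Φ j vQ '' A) = (S.D n).logvol j vQ A :=
  (S.D n).adm_and_logvol_eq_of_real Λ d e (hlogvol n) (hAdm n) hInd hΦ j vQ A hA

end Situation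

end Thm311

end IUTFork

end Summit.ABC

end
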